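import Summits.PneNP.PneNP.Theorems.ChebyshevTracialDesignLevelMarginals
import Summits.PneNP.PneNP.Theorems.ChebyshevTracialDesignProfileInterpolation
import HarnessLib

/-!
# Cell pnp-psdrank, route `ChebyshevTracialDesign`: the a-priori bound — sparse strategies are trivial for the
# crux `TracialDecayExp20`

STEP 0 of every argument about the crux (planner p1, HOME/pnp-psdrank-p1/N2-SpreadStructure.md, LINE CPD ¶1:
"rectangles with `min(μ,ν) < n^{−aD}/20` have `|V(R)| ≤ 20·min(μ,ν)` trivially"), proved for psd rectangles of every
dimension `r`:

* §1–§2 For a psd rectangle (`IsPsdRect`: `0 ⪯ X_U, Y_M ⪯ I`) `0 ≤ tr(X_U Y_M) ≤ min(tr X_U, tr Y_M)` (`tr(AB) ≥ 0`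
  for psd `A, B` is taken from the tree's `HasPsdFactorization.nonneg`), so — by the
  uniform marginals of the level classes (`ChebyshevTracialDesignLevelMarginals`) — the level profile satisfies
  `0 ≤ Φ(c) ≤ min(τ_X(t), τ_Y)` with the normalised TRACE DENSITIES `τ_X(t) = (Σ_{|U|=t} tr X_U)/(r·#{|U| = t})`,
  `τ_Y = (Σ_M tr Y_M)/(r·#M)` (`levelProfile_le_rowDensity`, `levelProfile_le_colDensity`), both in `[0, 1]`.
* §3 Consequently the normalised value of ANY multilevel weight of total variation `Σ|w_c| ≤ B` is at most
  `B · min(τ_X(t), τ_Y)` in absolute value (`value_div_le_variation_mul_min`, `abs_value_div_le`), and the conclusion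
  of the crux holds for every psd rectangle one of whose trace densities is `≤ γ/B` (`value_div_le_of_sparse`; for the
  route's designs `B = 20`, `γ = exp(−a·dq n)`: `value_div_le_of_sparse_design`). The open core of `TracialDecayExp20`
  is therefore the DENSE regime `τ_X(t), τ_Y > exp(−a·dq n)/20` (on top of junta / low-degree / equivariant
  strategies, settled elsewhere in this directory).

The densities are written out (no definitions are introduced).
WHAT THIS IS NOT: no statement about dense strategies; nothing on general psd rank. Supports crux stmt-PneNP-19878.
-/

set_option linter.dupNamespace false -- `Summit.PneNP.PneNP.…`: summit = sub-problem (D-0017)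

noncomputable section

namespace Summit.PneNP.PneNP.Theorems.ChebyshevTracialDesignAPrioriBounds

open Finset Matrix Literature.Barriers.PneNP Literature.Combinatorics.Optimization
open Summit.PneNP.PneNP.Theorems.ChebyshevTracialDesignProfileInterpolation (value_div_eq_sum_levelProfile)
open Summit.PneNP.PneNP.Theorems.ChebyshevTracialDesignLevelMarginals

variable {n : ℕ}

/-! ### §1 Trace inequalities for contractions -/

/-- `tr(A B) ≤ tr(B)` when `A ⪯ I` and `B ⪰ 0`. -/
theorem trace_mul_le_trace_right {r : ℕ} {A B : Matrix (Fin r) (Fin r) ℝ} (hA : (1 - A).PosSemidef)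
    (hB : B.PosSemidef) : (A * B).trace ≤ B.trace := by
  have h : 0 ≤ ((1 - A) * B).trace :=
    (show HasPsdFactorization (fun (_ : Unit) (_ : Unit) => ((1 - A) * B).trace) r from
      ⟨fun _ => 1 - A, fun _ => B, fun _ => hA, fun _ => hB, fun _ _ => rfl⟩).nonneg () ()
  rw [sub_mul, one_mul, trace_sub] at h
  linarith

/-- `tr(A B) ≤ tr(A)` when `A ⪰ 0` and `B ⪯ I`. -/
theorem trace_mul_le_trace_left {r : ℕ} {A B : Matrix (Fin r) (Fin r) ℝ} (hA : A.PosSemidef)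
    (hB : (1 - B).PosSemidef) : (A * B).trace ≤ A.trace := by
  have h : 0 ≤ (A * (1 - B)).trace :=
    (show HasPsdFactorization (fun (_ : Unit) (_ : Unit) => (A * (1 - B)).trace) r from
      ⟨fun _ => A, fun _ => 1 - B, fun _ => hA, fun _ => hB, fun _ _ => rfl⟩).nonneg () ()
  rw [mul_sub, mul_one, trace_sub] at h
  linarith

/-- `tr(A) ≤ r` when `A ⪯ I` (size `r`). -/
theorem trace_le_of_sub_posSemidef {r : ℕ} {A : Matrix (Fin r) (Fin r) ℝ} (hA : (1 - A).PosSemidef) :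
    A.trace ≤ r := by
  have h := hA.trace_nonneg
  rw [trace_sub, trace_one, Fintype.card_fin] at h
  linarith

/-! ### §2 Trace densities bound the level profile -/

/-- The column trace density `τ_Y = (Σ_M tr Y_M)/(r·#M)` of a psd rectangle is `≥ 0`. -/
theorem colDensity_nonneg {r : ℕ} {X : OddSet n → Matrix (Fin r) (Fin r) ℝ}
    {Y : PMatch n → Matrix (Fin r) (Fin r) ℝ} (h : IsPsdRect X Y) :
    0 ≤ (∑ M, (Y M).trace) / ((r : ℝ) * Fintype.card (PMatch n)) :=
  div_nonneg (sum_nonneg fun M _ => (h.2.1 M).1.trace_nonneg) (by positivity)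

/-- The column trace density of a psd rectangle is `≤ 1`. -/
theorem colDensity_le_one {r : ℕ} {X : OddSet n → Matrix (Fin r) (Fin r) ℝ}
    {Y : PMatch n → Matrix (Fin r) (Fin r) ℝ} (h : IsPsdRect X Y) :
    (∑ M, (Y M).trace) / ((r : ℝ) * Fintype.card (PMatch n)) ≤ 1 := by
  rcases Nat.eq_zero_or_pos r with rfl | hr
  · simp
  rcases isEmpty_or_nonempty (PMatch n) with hP | hP
  · simp
  have hden : (0 : ℝ) < (r : ℝ) * Fintype.card (PMatch n) := by
    have : (0 : ℝ) < Fintype.card (PMatch n) := by exact_mod_cast Fintype.card_pos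
    positivity
  rw [div_le_one hden]
  calc ∑ M, (Y M).trace ≤ ∑ _M : PMatch n, (r : ℝ) := sum_le_sum fun M _ => trace_le_of_sub_posSemidef (h.2.1 M).2
    _ = (r : ℝ) * Fintype.card (PMatch n) := by rw [sum_const, card_univ, nsmul_eq_mul, mul_comm]

/-- The row trace density `τ_X(t) = (Σ_{|U|=t} tr X_U)/(r·#{|U| = t})` of a psd rectangle is `≥ 0`. -/
theorem rowDensity_nonneg {t r : ℕ} {X : OddSet n → Matrix (Fin r) (Fin r) ℝ}
    {Y : PMatch n → Matrix (Fin r) (Fin r) ℝ} (h : IsPsdRect X Y) :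
    0 ≤ (∑ U ∈ univ.filter (fun U : OddSet n => U.1.card = t), (X U).trace) /
      ((r : ℝ) * (univ.filter (fun U : OddSet n => U.1.card = t)).card) :=
  div_nonneg (sum_nonneg fun U _ => (h.1 U).1.trace_nonneg) (by positivity)

/-- The row trace density of a psd rectangle is `≤ 1`. -/
theorem rowDensity_le_one {t r : ℕ} {X : OddSet n → Matrix (Fin r) (Fin r) ℝ}
    {Y : PMatch n → Matrix (Fin r) (Fin r) ℝ} (h : IsPsdRect X Y) :
    (∑ U ∈ univ.filter (fun U : OddSet n => U.1.card = t), (X U).trace) /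
      ((r : ℝ) * (univ.filter (fun U : OddSet n => U.1.card = t)).card) ≤ 1 := by
  rcases Nat.eq_zero_or_pos r with rfl | hr
  · simp
  rcases (univ.filter (fun U : OddSet n => U.1.card = t)).eq_empty_or_nonempty with hT | hT
  · rw [hT]; simp
  have hden : (0 : ℝ) < (r : ℝ) * (univ.filter (fun U : OddSet n => U.1.card = t)).card := by
    have : (0 : ℝ) < (univ.filter (fun U : OddSet n => U.1.card = t)).card := by exact_mod_cast hT.card_pos
    positivity
  rw [div_le_one hden]
  calc ∑ U ∈ univ.filter (fun U : OddSet n => U.1.card = t), (X U).trace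
      ≤ ∑ _U ∈ univ.filter (fun U : OddSet n => U.1.card = t), (r : ℝ) :=
        sum_le_sum fun U _ => trace_le_of_sub_posSemidef (h.1 U).2
    _ = (r : ℝ) * (univ.filter (fun U : OddSet n => U.1.card = t)).card := by rw [sum_const, nsmul_eq_mul, mul_comm]

/-- The level profile of a psd rectangle is nonnegative. -/
theorem levelProfile_nonneg {t r c : ℕ} {X : OddSet n → Matrix (Fin r) (Fin r) ℝ}
    {Y : PMatch n → Matrix (Fin r) (Fin r) ℝ} (h : IsPsdRect X Y) : 0 ≤ levelProfile n t r X Y c :=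
  div_nonneg (sum_nonneg fun q _ =>
    (show HasPsdFactorization (fun U M => (X U * Y M).trace) r from
      ⟨X, Y, fun U => (h.1 U).1, fun M => (h.2.1 M).1, fun _ _ => rfl⟩).nonneg q.1 q.2) (by positivity)

/-- **Profile ≤ column trace density**: `Φ(c) ≤ τ_Y` for every psd rectangle, every cut size `t` and every level `c`
(uniform column marginal of `Q_c(t)` and `tr(X_U Y_M) ≤ tr(Y_M)`). -/
theorem levelProfile_le_colDensity {t r c : ℕ} {X : OddSet n → Matrix (Fin r) (Fin r) ℝ}
    {Y : PMatch n → Matrix (Fin r) (Fin r) ℝ} (h : IsPsdRect X Y) :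
    levelProfile n t r X Y c ≤ (∑ M, (Y M).trace) / ((r : ℝ) * Fintype.card (PMatch n)) := by
  rcases (Qset n t c).eq_empty_or_nonempty with hQ | ⟨q₀, hq₀⟩
  · unfold levelProfile
    rw [hQ, sum_empty, zero_div]
    exact colDensity_nonneg h
  rcases Nat.eq_zero_or_pos r with rfl | hr
  · unfold levelProfile
    simp
  set κ : ℕ := (univ.filter fun U : OddSet n => U.1.card = t ∧ cc U q₀.2 = c).card with hκ
  have hnum : ∑ q ∈ Qset n t c, (X q.1 * Y q.2).trace ≤ (κ : ℝ) * ∑ M, (Y M).trace := by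
    calc ∑ q ∈ Qset n t c, (X q.1 * Y q.2).trace ≤ ∑ q ∈ Qset n t c, (Y q.2).trace :=
          sum_le_sum fun q _ => trace_mul_le_trace_right (h.1 q.1).2 (h.2.1 q.2).1
      _ = (κ : ℝ) * ∑ M, (Y M).trace := sum_Qset_snd t c (fun M => (Y M).trace) q₀.2
  have hP : (0 : ℝ) < Fintype.card (PMatch n) := by exact_mod_cast Fintype.card_pos_iff.2 ⟨q₀.2⟩
  have hκpos : (0 : ℝ) < κ := by
    have hmem : q₀.1 ∈ univ.filter (fun U : OddSet n => U.1.card = t ∧ cc U q₀.2 = c) := by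
      rw [mem_filter]
      exact ⟨mem_univ _, (mem_Qset_iff.1 hq₀)⟩
    exact_mod_cast card_pos.2 ⟨_, hmem⟩
  have hr' : (0 : ℝ) < r := by exact_mod_cast hr
  unfold levelProfile
  rw [card_Qset_eq_colCount_mul t c q₀.2, ← hκ]
  calc (∑ q ∈ Qset n t c, (X q.1 * Y q.2).trace) / ((r : ℝ) * ((κ : ℝ) * Fintype.card (PMatch n)))
      ≤ ((κ : ℝ) * ∑ M, (Y M).trace) / ((r : ℝ) * ((κ : ℝ) * Fintype.card (PMatch n))) :=
        div_le_div_of_nonneg_right hnum (by positivity)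
    _ = (∑ M, (Y M).trace) / ((r : ℝ) * Fintype.card (PMatch n)) := by
        rw [mul_left_comm (r : ℝ), mul_div_mul_left _ _ hκpos.ne']

/-- **Profile ≤ row trace density**: `Φ(c) ≤ τ_X(t)` for every psd rectangle, every cut size `t` and every level `c`
(uniform row marginal of `Q_c(t)` and `tr(X_U Y_M) ≤ tr(X_U)`). -/
theorem levelProfile_le_rowDensity {t r c : ℕ} {X : OddSet n → Matrix (Fin r) (Fin r) ℝ}
    {Y : PMatch n → Matrix (Fin r) (Fin r) ℝ} (h : IsPsdRect X Y) :
    levelProfile n t r X Y c ≤ (∑ U ∈ univ.filter (fun U : OddSet n => U.1.card = t), (X U).trace) /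
      ((r : ℝ) * (univ.filter (fun U : OddSet n => U.1.card = t)).card) := by
  rcases (Qset n t c).eq_empty_or_nonempty with hQ | ⟨q₀, hq₀⟩
  · unfold levelProfile
    rw [hQ, sum_empty, zero_div]
    exact rowDensity_nonneg h
  rcases Nat.eq_zero_or_pos r with rfl | hr
  · unfold levelProfile
    simp
  have ht : q₀.1.1.card = t := (mem_Qset_iff.1 hq₀).1
  set κ : ℕ := (univ.filter fun M : PMatch n => cc q₀.1 M = c).card with hκ
  set T : Finset (OddSet n) := univ.filter (fun U : OddSet n => U.1.card = t) with hT
  have hnum : ∑ q ∈ Qset n t c, (X q.1 * Y q.2).trace ≤ (κ : ℝ) * ∑ U ∈ T, (X U).trace := by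
    calc ∑ q ∈ Qset n t c, (X q.1 * Y q.2).trace ≤ ∑ q ∈ Qset n t c, (X q.1).trace :=
          sum_le_sum fun q _ => trace_mul_le_trace_left (h.1 q.1).1 (h.2.1 q.2).2
      _ = (κ : ℝ) * ∑ U ∈ T, (X U).trace := sum_Qset_fst t c (fun U => (X U).trace) q₀.1 ht
  have hTpos : (0 : ℝ) < T.card := by
    have : q₀.1 ∈ T := by rw [hT, mem_filter]; exact ⟨mem_univ _, ht⟩
    exact_mod_cast card_pos.2 ⟨_, this⟩
  have hκpos : (0 : ℝ) < κ := by
    have hmem : q₀.2 ∈ univ.filter (fun M : PMatch n => cc q₀.1 M = c) := by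
      rw [mem_filter]
      exact ⟨mem_univ _, (mem_Qset_iff.1 hq₀).2⟩
    exact_mod_cast card_pos.2 ⟨_, hmem⟩
  have hr' : (0 : ℝ) < r := by exact_mod_cast hr
  unfold levelProfile
  rw [card_Qset_eq_rowCount_mul t c q₀.1 ht, ← hκ, ← hT]
  calc (∑ q ∈ Qset n t c, (X q.1 * Y q.2).trace) / ((r : ℝ) * ((κ : ℝ) * T.card))
      ≤ ((κ : ℝ) * ∑ U ∈ T, (X U).trace) / ((r : ℝ) * ((κ : ℝ) * T.card)) :=
        div_le_div_of_nonneg_right hnum (by positivity)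
    _ = (∑ U ∈ T, (X U).trace) / ((r : ℝ) * T.card) := by
        rw [mul_left_comm (r : ℝ), mul_div_mul_left _ _ hκpos.ne']

/-- The level profile of a psd rectangle is at most the smaller of the two trace densities. -/
theorem levelProfile_le_min {t r c : ℕ} {X : OddSet n → Matrix (Fin r) (Fin r) ℝ}
    {Y : PMatch n → Matrix (Fin r) (Fin r) ℝ} (h : IsPsdRect X Y) :
    levelProfile n t r X Y c ≤
      min ((∑ U ∈ univ.filter (fun U : OddSet n => U.1.card = t), (X U).trace) /
            ((r : ℝ) * (univ.filter (fun U : OddSet n => U.1.card = t)).card))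
          ((∑ M, (Y M).trace) / ((r : ℝ) * Fintype.card (PMatch n))) :=
  le_min (levelProfile_le_rowDensity h) (levelProfile_le_colDensity h)

/-! ### §3 The a-priori bound on the value; sparse strategies are trivial -/

/-- If every level profile value on the support `C` is `≤ τ` (and profiles are `≥ 0`, automatic for psd rectangles),
the normalised value of the multilevel weight is at most `(Σ_c |w_c|) · τ`. -/
theorem value_div_le_variation_mul {t r : ℕ} (hr : 0 < r) (C : Finset ℕ) (w : ℕ → ℝ)
    {X : OddSet n → Matrix (Fin r) (Fin r) ℝ} {Y : PMatch n → Matrix (Fin r) (Fin r) ℝ} (h : IsPsdRect X Y)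
    {τ : ℝ} (hτ : ∀ c ∈ C, levelProfile n t r X Y c ≤ τ) :
    (∑ U, ∑ M, levelWeight n t C w U M * (X U * Y M).trace) / r ≤ (∑ c ∈ C, |w c|) * τ := by
  rw [value_div_eq_sum_levelProfile hr, sum_mul]
  refine sum_le_sum fun c hc => ?_
  calc w c * levelProfile n t r X Y c ≤ |w c| * levelProfile n t r X Y c :=
        mul_le_mul_of_nonneg_right (le_abs_self _) (levelProfile_nonneg h)
    _ ≤ |w c| * τ := mul_le_mul_of_nonneg_left (hτ c hc) (abs_nonneg _)

/-- **A-priori bound**: for every psd rectangle of dimension `r ≥ 1` and every multilevel weight on the `t`-cuts,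
`value / r ≤ (Σ_c |w_c|) · min(τ_X(t), τ_Y)`. -/
theorem value_div_le_variation_mul_min {t r : ℕ} (hr : 0 < r) (C : Finset ℕ) (w : ℕ → ℝ)
    {X : OddSet n → Matrix (Fin r) (Fin r) ℝ} {Y : PMatch n → Matrix (Fin r) (Fin r) ℝ} (h : IsPsdRect X Y) :
    (∑ U, ∑ M, levelWeight n t C w U M * (X U * Y M).trace) / r ≤
      (∑ c ∈ C, |w c|) *
        min ((∑ U ∈ univ.filter (fun U : OddSet n => U.1.card = t), (X U).trace) /
              ((r : ℝ) * (univ.filter (fun U : OddSet n => U.1.card = t)).card))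
            ((∑ M, (Y M).trace) / ((r : ℝ) * Fintype.card (PMatch n))) :=
  value_div_le_variation_mul hr C w h fun _ _ => levelProfile_le_min h

/-- The bound is two-sided: `|value / r| ≤ (Σ_c |w_c|) · min(τ_X(t), τ_Y)`. -/
theorem abs_value_div_le {t r : ℕ} (hr : 0 < r) (C : Finset ℕ) (w : ℕ → ℝ)
    {X : OddSet n → Matrix (Fin r) (Fin r) ℝ} {Y : PMatch n → Matrix (Fin r) (Fin r) ℝ} (h : IsPsdRect X Y) :
    |(∑ U, ∑ M, levelWeight n t C w U M * (X U * Y M).trace) / r| ≤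
      (∑ c ∈ C, |w c|) *
        min ((∑ U ∈ univ.filter (fun U : OddSet n => U.1.card = t), (X U).trace) /
              ((r : ℝ) * (univ.filter (fun U : OddSet n => U.1.card = t)).card))
            ((∑ M, (Y M).trace) / ((r : ℝ) * Fintype.card (PMatch n))) := by
  rw [abs_le]
  refine ⟨?_, value_div_le_variation_mul_min hr C w h⟩
  have hneg := value_div_le_variation_mul_min (t := t) hr C (fun c => -w c) h
  have hsum : ∑ U, ∑ M, levelWeight n t C (fun c => -w c) U M * (X U * Y M).trace =
      -∑ U, ∑ M, levelWeight n t C w U M * (X U * Y M).trace := by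
    rw [← neg_eq_iff_eq_neg, ← sum_neg_distrib]
    refine (sum_congr rfl fun U _ => ?_).symm
    rw [← sum_neg_distrib]
    refine sum_congr rfl fun M _ => ?_
    rw [← neg_mul]
    congr 1
    simp only [levelWeight, ← sum_neg_distrib]
    refine sum_congr rfl fun c _ => ?_
    split_ifs <;> simp [neg_div]
  simp only [abs_neg] at hneg
  rw [hsum, neg_div] at hneg
  linarith

/-- **Sparse strategies are trivial**: if `Σ_c |w_c| ≤ B` (`B > 0`) and one of the two trace densities of the psd
rectangle is `≤ γ / B`, then `value / r ≤ γ` — the conclusion of `TracialValueLEAt` for this strategy, with no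
hypothesis on the other side and none beyond `IsPsdRect`. -/
theorem value_div_le_of_sparse {t r : ℕ} (hr : 0 < r) {B γ : ℝ} (hB : 0 < B) {C : Finset ℕ} {w : ℕ → ℝ}
    (hw : ∑ c ∈ C, |w c| ≤ B) {X : OddSet n → Matrix (Fin r) (Fin r) ℝ}
    {Y : PMatch n → Matrix (Fin r) (Fin r) ℝ} (h : IsPsdRect X Y)
    (hsparse : min ((∑ U ∈ univ.filter (fun U : OddSet n => U.1.card = t), (X U).trace) /
                      ((r : ℝ) * (univ.filter (fun U : OddSet n => U.1.card = t)).card))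
                    ((∑ M, (Y M).trace) / ((r : ℝ) * Fintype.card (PMatch n))) ≤ γ / B) :
    (∑ U, ∑ M, levelWeight n t C w U M * (X U * Y M).trace) / r ≤ γ := by
  have hm : 0 ≤ min ((∑ U ∈ univ.filter (fun U : OddSet n => U.1.card = t), (X U).trace) /
                      ((r : ℝ) * (univ.filter (fun U : OddSet n => U.1.card = t)).card))
                    ((∑ M, (Y M).trace) / ((r : ℝ) * Fintype.card (PMatch n))) :=
    le_min (rowDensity_nonneg h) (colDensity_nonneg h)
  calc (∑ U, ∑ M, levelWeight n t C w U M * (X U * Y M).trace) / r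
      ≤ (∑ c ∈ C, |w c|) * _ := value_div_le_variation_mul_min hr C w h
    _ ≤ B * (γ / B) := mul_le_mul hw hsparse hm hB.le
    _ = γ := mul_div_cancel₀ γ hB.ne'

/-- **The crux below density `exp(−a·dq n)/20`**: for every exact design of variation `≤ 20` (in particular every
balanced one the crux `TracialDecayExp20` quantifies over) and every psd rectangle of dimension `r ≥ 1` one of whose
trace densities is `≤ exp(−a·dq n)/20`, the value is `≤ r · exp(−a·dq n)`. The open content of the crux is the dense
regime. -/
theorem value_div_le_of_sparse_design {t T D r : ℕ} (hr : 0 < r) {a : ℝ} {C : Finset ℕ} {w : ℕ → ℝ}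
    (hdes : IsExactDesign n t T D 20 C w) {X : OddSet n → Matrix (Fin r) (Fin r) ℝ}
    {Y : PMatch n → Matrix (Fin r) (Fin r) ℝ} (h : IsPsdRect X Y)
    (hsparse : min ((∑ U ∈ univ.filter (fun U : OddSet n => U.1.card = t), (X U).trace) /
                      ((r : ℝ) * (univ.filter (fun U : OddSet n => U.1.card = t)).card))
                    ((∑ M, (Y M).trace) / ((r : ℝ) * Fintype.card (PMatch n))) ≤
                Real.exp (-(a * (dq n : ℝ))) / 20) :
    (∑ U, ∑ M, levelWeight n t C w U M * (X U * Y M).trace) / r ≤ Real.exp (-(a * (dq n : ℝ))) :=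
  value_div_le_of_sparse hr (by norm_num) hdes.2.2.2.2.2.2 h hsparse

/-! ### §4 Strategies induced by a factorization are never very sparse (appended 2026-08-26) -/

/-- **Induced strategies are dense.** If on the `t`-cuts `S(U,M) = r²·Δ·tr(X_U Y_M)` (the weak Briët–Dadush–Pokutta
rescaling of a size-`r` psd factorization of `S ≤ Δ`, as in the route's assembly) for a psd rectangle `(X, Y)` with
`r, Δ > 0`, then the average of `S` over (`t`-cuts × matchings) is at most `r³·Δ·min(τ_X(t), τ_Y)`: both trace densities are
`≥ E[S]/(r³Δ)`. For the odd-cut slack (`E[cc − 1] ≈ n/4`, `Δ = n²`) inside the budget `r²·n < exp(a·dq n)` this is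
`≥ √n·exp(−1.5·a·dq n)/6`, so the factorizations the crux is applied to live at densities within a factor `exp(a·dq n /2)` of the
triviality threshold `exp(−a·dq n)/20` of §3. -/
theorem avg_le_cube_mul_min_density {t r : ℕ} (hr : 0 < r) {Δ : ℝ} (hΔ : 0 < Δ) (S : OddSet n → PMatch n → ℝ)
    {X : OddSet n → Matrix (Fin r) (Fin r) ℝ} {Y : PMatch n → Matrix (Fin r) (Fin r) ℝ} (h : IsPsdRect X Y)
    (hS : ∀ U M, U.1.card = t → S U M = (r : ℝ) ^ 2 * Δ * (X U * Y M).trace)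
    (hT : (univ.filter (fun U : OddSet n => U.1.card = t)).Nonempty) (hP : Nonempty (PMatch n)) :
    (∑ U ∈ univ.filter (fun U : OddSet n => U.1.card = t), ∑ M, S U M) /
        (((univ.filter (fun U : OddSet n => U.1.card = t)).card : ℝ) * Fintype.card (PMatch n)) ≤
      (r : ℝ) ^ 3 * Δ *
        min ((∑ U ∈ univ.filter (fun U : OddSet n => U.1.card = t), (X U).trace) /
              ((r : ℝ) * (univ.filter (fun U : OddSet n => U.1.card = t)).card))
            ((∑ M, (Y M).trace) / ((r : ℝ) * Fintype.card (PMatch n))) := by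
  set T : Finset (OddSet n) := univ.filter (fun U : OddSet n => U.1.card = t) with hTdef
  have hr' : (0 : ℝ) < r := by exact_mod_cast hr
  have hTpos : (0 : ℝ) < T.card := by exact_mod_cast hT.card_pos
  have hPpos : (0 : ℝ) < Fintype.card (PMatch n) := by exact_mod_cast Fintype.card_pos
  have hsum : ∑ U ∈ T, ∑ M, S U M = (r : ℝ) ^ 2 * Δ * ∑ U ∈ T, ∑ M, (X U * Y M).trace := by
    rw [mul_sum]
    refine sum_congr rfl fun U hU => ?_
    rw [mul_sum]
    exact sum_congr rfl fun M _ => hS U M (mem_filter.1 hU).2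
  -- the two one-sided bounds on `Σ tr(X_U Y_M)`
  have hY : ∑ U ∈ T, ∑ M, (X U * Y M).trace ≤ (T.card : ℝ) * ∑ M, (Y M).trace := by
    calc ∑ U ∈ T, ∑ M, (X U * Y M).trace ≤ ∑ _U ∈ T, ∑ M, (Y M).trace :=
          sum_le_sum fun U _ => sum_le_sum fun M _ => trace_mul_le_trace_right (h.1 U).2 (h.2.1 M).1
      _ = (T.card : ℝ) * ∑ M, (Y M).trace := by rw [sum_const, nsmul_eq_mul]
  have hX : ∑ U ∈ T, ∑ M, (X U * Y M).trace ≤ (Fintype.card (PMatch n) : ℝ) * ∑ U ∈ T, (X U).trace := by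
    calc ∑ U ∈ T, ∑ M, (X U * Y M).trace ≤ ∑ U ∈ T, ∑ _M : PMatch n, (X U).trace :=
          sum_le_sum fun U _ => sum_le_sum fun M _ => trace_mul_le_trace_left (h.1 U).1 (h.2.1 M).2
      _ = (Fintype.card (PMatch n) : ℝ) * ∑ U ∈ T, (X U).trace := by
          rw [mul_sum]; exact sum_congr rfl fun U _ => by rw [sum_const, card_univ, nsmul_eq_mul]
  rw [hsum, div_le_iff₀ (by positivity)]
  rcases le_total ((∑ U ∈ T, (X U).trace) / ((r : ℝ) * T.card))
      ((∑ M, (Y M).trace) / ((r : ℝ) * Fintype.card (PMatch n))) with hle | hle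
  · rw [min_eq_left hle]
    calc (r : ℝ) ^ 2 * Δ * ∑ U ∈ T, ∑ M, (X U * Y M).trace
        ≤ (r : ℝ) ^ 2 * Δ * ((Fintype.card (PMatch n) : ℝ) * ∑ U ∈ T, (X U).trace) :=
          mul_le_mul_of_nonneg_left hX (by positivity)
      _ = (r : ℝ) ^ 3 * Δ * ((∑ U ∈ T, (X U).trace) / ((r : ℝ) * T.card)) * ((T.card : ℝ) * Fintype.card (PMatch n)) := by
          field_simp
  · rw [min_eq_right hle]
    calc (r : ℝ) ^ 2 * Δ * ∑ U ∈ T, ∑ M, (X U * Y M).trace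
        ≤ (r : ℝ) ^ 2 * Δ * ((T.card : ℝ) * ∑ M, (Y M).trace) := mul_le_mul_of_nonneg_left hY (by positivity)
      _ = (r : ℝ) ^ 3 * Δ * ((∑ M, (Y M).trace) / ((r : ℝ) * Fintype.card (PMatch n))) *
            ((T.card : ℝ) * Fintype.card (PMatch n)) := by
          field_simp

end Summit.PneNP.PneNP.Theorems.ChebyshevTracialDesignAPrioriBounds

end
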